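import Mathlib
import Summits.NavierStokesRegularity.NavierStokesRegularity.Theorems.TaoLadderRungTwoBreakNoSurvivingEternalViscBddOneSubDyadicSpread
import HarnessLib

/-!
# The square-free / sub-dyadic ONE-MODE corner of K2(1): a square-free table — in particular EVERY table of
  `E₂(R)` below the dyadic spread `R < 2` — never blows up robustly from a one-mode (single-wavelet) datum,
  at ANY scale ratio; there `TaoLadderRungTwoBreak.BlowupRigidityOne` (stmt-NavierStokesRegularity-20206) and the
  rung leaf `Target` hold vacuously

MODEL lattice ODEs only (Tao 2016 §4 (4.1)–(4.3), Lemma 4.1 (4.5)–(4.11), Thm. 4.2 statement shape); nothing here is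
a statement about the Navier–Stokes equations; NO item is closed (`--supports stmt-NavierStokesRegularity-20206`).
DEF-FREE: the frozen family is written out as the lambda `fun i n _ => if n = n₀ then X₀ i else 0` (the right-hand
side of (4.7)); «`X₀` charges at most one mode» is the hypothesis `∀ j k, X₀ j ≠ 0 → X₀ k ≠ 0 → j = k` (covers
`X₀ = 0` and `m = 0`), «`X₀` charges only mode `b`» the hypothesis `∀ j ≠ b, X₀ j = 0`.

Companion of `…BlowupRigidityOneVoidTables` (outflow-free tables) and `…BlowupRigidityOneLiveTables` (zero datum):
a third explicit sub-class of «`∀ R ≥ 1 … ∀ α ∈ InTableClass R … ∀ X₀`» on which the HYPOTHESIS `NoGlobalCascade ε₀ α X₀`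
of K2(1) is void, uniformly in `ε₀`.

* `isSquareFreeCoeff_of_lt_two` — the bridge not yet in the tree: an `R`-comparable symmetric cancelling table with
  `0 < R < 2` is SQUARE-FREE (`TaoCascade.IsSquareFreeCoeff`: `α_{i i j,μ} = 0` for `μ ∈ S` with `μ₁ = μ₂`, i.e.
  `μ = (0,0,0)` or `(0,0,1)`), by `SubDyadicSpread.sqCoeff_eq_zero_of_lt_two` (the cancellation sum at `(b,b,a)`
  reads `α_{bba} = −2α_{abb}`, and a non-zero comparable entry `≥ R⁻¹ > 1/2` would force a modulus `> 1`).
* `quadTerm_frozen_eq_zero_of_squareFree` — on a square-free table the main term (4.8) VANISHES identically on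
  the frozen family `X_{i,n}(t) = X₀ᵢ·1_{n = n₀}` of a datum charging at most one mode: a product
  `X_{i₁,n−μ₃+μ₁} X_{i₂,n−μ₃+μ₂}` is non-zero only for `i₁ = i₂` and `μ₁ = μ₂`, i.e. in front of a square coefficient.
* `cascadeODESolutionFrom_frozen_of_squareFree`, `hasGlobal_frozen_of_squareFree` — hence the frozen family with
  `E = ½X²` satisfies ALL the conclusions (4.5)–(4.11) of Lemma 4.1 globally with zero defects `K₁ = K₂ = 0`, from
  every starting shell `n₀` and at every `ε₀` (a one-mode state of a square-free table is an equilibrium — the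
  lattice version of the tree's `splitDelayCircuit_single`).
* `not_noGlobalCascade_of_squareFree`, `not_noGlobalCascade_oneMode_of_squareFree`,
  `not_noGlobalCascade_oneMode_of_lt_two`, `not_noGlobalCascade_indicator_of_lt_two` — NO Theorem-4.2-level blow-up
  from such data on a square-free table, in particular on any table of `E₂(R)`, `R < 2`, and in particular from Tao's
  own datum format `X₀ = a·1_{i₀}` ((4.4)/(4.7)); every `ε₀`.
* `two_modes_of_noGlobalCascade_of_lt_two`, `exists_sqCoeff_ne_zero_of_noGlobalCascade_oneMode` — NUMBERS for the
  census: below the dyadic spread a robust blow-up needs a datum charging TWO distinct modes; at any spread a robust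
  blow-up from a datum charging at most one mode needs a non-zero SQUARE coefficient `α_{j j i,(0,0,0)}` or
  `α_{j j i,(0,0,1)}` (Tao's Table 1: the clock `εX₁² ↦ X₂`, `not_isSquareFreeCoeff_taoCoeff`).
* `blowupRigidityOne_on_oneMode_of_lt_two`, `target_on_oneMode_of_lt_two` — the K2(1) implication and the rung
  leaf restricted to `0 < R < 2` and one-mode data hold for EVERY `ε₀` (vacuously): together with VoidTables /
  LiveTables, the content of K2(1) below the dyadic spread sits on multi-mode data of tables with a live CROSS
  outflow `α_{jk i,(0,0,1)}`, `j ≠ k`.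

HONEST LABEL: calibration of one aside leaf on an explicit sub-class; no stub, crux, rung or summit is proved; rung 0.
ROUTE-INDEPENDENT MODULE (no `Theses` import: the two restricted statements are spelled out, not named), so that
sibling helper files may import it without entering the route file's rebuild cone.
-/

noncomputable section

-- the summit and its single sub-problem share the name (CONVENTIONS §1)
set_option linter.dupNamespace false

open Set Filter Topology MeasureTheory

namespace Summit.NavierStokesRegularity.NavierStokesRegularity.Theorems

namespace BlowupRigidityOne

open Literature.Analysis.FluidPDE Literature.Analysis.FluidPDE.TaoCascade
open Summit.NavierStokesRegularity.NavierStokesRegularity.Theorems.NoSurvivingEternalViscBddOne.SubDyadicSpread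
  (sqCoeff_eq_zero_of_lt_two)

variable {m : ℕ} {R : ℝ} {α : Fin m → Fin m → Fin m → ℤ × ℤ × ℤ → ℝ}

/-! ## Below the dyadic spread every comparable table is square-free -/

/-- **`E₂(R)` is square-free for `R < 2`.** On a symmetric, cancelling, `R`-comparable table with `0 < R < 2` every
structure constant `α_{i i j,μ}` whose two inputs are the same mode at the same scale (`μ ∈ S`, `μ₁ = μ₂`, i.e.
`μ = (0,0,0)` or `(0,0,1)`) vanishes: the table is square-free in the sense of `TaoCascade.IsSquareFreeCoeff`.
[cite: Tao2016AveragedNS, §4 (4.1)–(4.3), §6.1; tree `SubDyadicSpread.sqCoeff_eq_zero_of_lt_two`; cell vocabulary (`InTableClass`, `IsSquareFreeCoeff`)] -/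
theorem isSquareFreeCoeff_of_lt_two (hα : InTableClass R α) (hR0 : 0 < R) (hR : R < 2) :
    IsSquareFreeCoeff α := by
  intro i j μ hμ h12
  rw [mem_shiftSet_iff] at hμ
  rcases hμ with rfl | rfl | rfl | rfl
  · exact (sqCoeff_eq_zero_of_lt_two hα hR0 hR j i).2.2.2.1
  · exact absurd h12 (by decide)
  · exact absurd h12 (by decide)
  · exact (sqCoeff_eq_zero_of_lt_two hα hR0 hR j i).1

/-- A datum charging only the mode `b` charges at most one mode. [elementary] -/
theorem atMostOneMode_of_oneMode {X₀ : Fin m → ℝ} {b : Fin m} (hX₀ : ∀ j, j ≠ b → X₀ j = 0) :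
    ∀ j k, X₀ j ≠ 0 → X₀ k ≠ 0 → j = k := by
  intro j k hj hk
  have hjb : j = b := by by_contra h; exact hj (hX₀ j h)
  have hkb : k = b := by by_contra h; exact hk (hX₀ k h)
  rw [hjb, hkb]

/-! ## The frozen one-mode family of a square-free table -/

/-- **The main term (4.8) vanishes on the frozen family of a square-free table from a datum charging at most one
mode.** For the time-independent family `X_{i,n}(t) = X₀ᵢ·1_{n=n₀}` every summand of `quadTerm` is zero: a non-zero
product `X_{i₁,n−μ₃+μ₁} X_{i₂,n−μ₃+μ₂}` forces `X₀ i₁ ≠ 0 ≠ X₀ i₂`, hence `i₁ = i₂`, and `μ₁ = μ₂`, where the square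
coefficient `α_{i₁ i₁ i,μ}` vanishes. Any `ε₀`.
[cite: Tao2016AveragedNS, §4 (4.1), Lemma 4.1 (4.8); cell vocabulary (`IsSquareFreeCoeff`)] -/
theorem quadTerm_frozen_eq_zero_of_squareFree (hsq : IsSquareFreeCoeff α) {X₀ : Fin m → ℝ}
    (hX₀ : ∀ j k, X₀ j ≠ 0 → X₀ k ≠ 0 → j = k) (ε₀ : ℝ) (n₀ : ℤ) (i : Fin m) (n : ℤ) (t : ℝ) :
    quadTerm ε₀ α (fun i n _ => if n = n₀ then X₀ i else 0) i n t = 0 := by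
  simp only [quadTerm]
  refine Finset.sum_eq_zero fun i₁ _ => Finset.sum_eq_zero fun i₂ _ => Finset.sum_eq_zero fun μ hμ => ?_
  by_cases h1 : n - μ.2.2 + μ.1 = n₀
  · by_cases h2 : n - μ.2.2 + μ.2.1 = n₀
    · rw [if_pos h1, if_pos h2]
      by_cases hi₁ : X₀ i₁ = 0
      · rw [hi₁, zero_mul, mul_zero]
      · by_cases hi₂ : X₀ i₂ = 0
        · rw [hi₂, mul_zero, mul_zero]
        · have h12 : i₁ = i₂ := hX₀ i₁ i₂ hi₁ hi₂
          have hα0 : α i₁ i₂ i μ = 0 := by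
            rw [← h12]
            exact hsq i₁ i μ hμ (by omega)
          rw [hα0, zero_mul, zero_mul]
    · rw [if_neg h2, mul_zero, mul_zero]
  · rw [if_neg h1, zero_mul, mul_zero]

/-- `|X₀ i| ≤ Σ_j |X₀ j|`. [elementary] -/
theorem abs_apply_le_sum_abs (X₀ : Fin m → ℝ) (i : Fin m) : |X₀ i| ≤ ∑ j, |X₀ j| :=
  Finset.single_le_sum (f := fun j => |X₀ j|) (fun j _ => abs_nonneg (X₀ j)) (Finset.mem_univ i)

/-- `√(½ x²) ≤ |x|`. [elementary] -/
theorem sqrt_half_sq_le_abs (x : ℝ) : Real.sqrt ((1 / 2) * x ^ 2) ≤ |x| := by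
  rw [← Real.sqrt_sq_eq_abs]
  exact Real.sqrt_le_sqrt (by nlinarith [sq_nonneg x])

/-- **A state charging at most one mode of one shell is an equilibrium of a square-free lattice, with all of
(4.5)–(4.11).** For a square-free table `α`, ANY `ε₀`, any starting shell `n₀` and a datum `X₀` charging at most one
mode, the frozen family `X_{i,n}(t) = X₀ᵢ·1_{n=n₀}` with `E_{i,n} = ½X_{i,n}²` satisfies the conclusions of Lemma 4.1
globally with zero motion and energy defects (`K₁ = K₂ = 0`): it is `C¹`, obeys the a priori weight (4.5) (one
non-zero shell; bound `(1 + |(1+ε₀)^{10n₀}|)·Σ_j |X₀ j|`), the initial conditions (4.6)–(4.7), the EXACT motion law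
(`quadTerm ≡ 0 = Ẋ`), the energy inequality, the defect bounds with equality, and has no modes below `n₀`.
[cite: Tao2016AveragedNS, §4 Lemma 4.1 (4.5)–(4.11); cell vocabulary (`IsSquareFreeCoeff`; the lattice form of the tree's `splitDelayCircuit_single`)] -/
theorem cascadeODESolutionFrom_frozen_of_squareFree (hsq : IsSquareFreeCoeff α) {X₀ : Fin m → ℝ}
    (hX₀ : ∀ j k, X₀ j ≠ 0 → X₀ k ≠ 0 → j = k) (ε₀ : ℝ) (n₀ : ℤ) :
    CascadeODESolutionFrom ε₀ α 0 0 n₀ X₀ (fun i n _ => if n = n₀ then X₀ i else 0)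
      (fun i n _ => (1 / 2) * (if n = n₀ then X₀ i else 0) ^ 2) where
  contDiffOn_X _ _ := contDiffOn_const
  contDiffOn_E _ _ := contDiffOn_const
  nonneg_E _ _ _ _ := by positivity
  apriori_X T _ := by
    refine ⟨(1 + |(1 + ε₀) ^ ((10 : ℝ) * n₀)|) * ∑ j, |X₀ j|, fun t _ i n => ?_⟩
    by_cases hn : n = n₀
    · subst hn
      rw [if_pos rfl]
      exact mul_le_mul (by linarith [le_abs_self ((1 + ε₀) ^ ((10 : ℝ) * n))]) (abs_apply_le_sum_abs X₀ i)
        (abs_nonneg _) (by positivity)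
    · rw [if_neg hn, abs_zero, mul_zero]
      positivity
  apriori_E T _ := by
    refine ⟨(1 + |(1 + ε₀) ^ ((10 : ℝ) * n₀)|) * ∑ j, |X₀ j|, fun t _ i n => ?_⟩
    by_cases hn : n = n₀
    · subst hn
      rw [if_pos rfl]
      exact mul_le_mul (by linarith [le_abs_self ((1 + ε₀) ^ ((10 : ℝ) * n))])
        ((sqrt_half_sq_le_abs (X₀ i)).trans (abs_apply_le_sum_abs X₀ i)) (Real.sqrt_nonneg _) (by positivity)
    · rw [if_neg hn]
      simp only [ne_eq, OfNat.ofNat_ne_zero, not_false_eq_true, zero_pow, mul_zero, Real.sqrt_zero]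
      positivity
  init_E _ _ := rfl
  init_X _ _ := rfl
  motion i n t _ := by
    rw [quadTerm_frozen_eq_zero_of_squareFree hsq hX₀, derivWithin_fun_const]
    simp
  energy i n t _ := by
    rw [quadTerm_frozen_eq_zero_of_squareFree hsq hX₀, derivWithin_fun_const]
    simp
  defect_lower _ _ _ _ := le_rfl
  defect_upper _ _ _ _ := by simp
  noLow_X i n t hn _ := by
    have : ¬ n = n₀ := by omega
    simp [this]
  noLow_E i n t hn _ := by
    have : ¬ n = n₀ := by omega
    simp [this]

/-- **Global pseudo-solutions from a datum charging at most one mode on a square-free table, every shell, every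
`ε₀`.** `HasGlobal ε₀ α 0 0 n₀ X₀` (zero defects) — witnessed by the frozen family.
[cite: Tao2016AveragedNS, §4 Lemma 4.1 (4.5)–(4.11), Thm. 4.2; cell vocabulary (`HasGlobal`, `IsSquareFreeCoeff`)] -/
theorem hasGlobal_frozen_of_squareFree (hsq : IsSquareFreeCoeff α) {X₀ : Fin m → ℝ}
    (hX₀ : ∀ j k, X₀ j ≠ 0 → X₀ k ≠ 0 → j = k) (ε₀ : ℝ) (n₀ : ℤ) : HasGlobal ε₀ α 0 0 n₀ X₀ :=
  ⟨_, _, cascadeODESolutionFrom_frozen_of_squareFree hsq hX₀ ε₀ n₀⟩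

/-! ## No robust blow-up from one-mode data -/

/-- **A square-free table never blows up robustly from a datum charging at most one mode** — at ANY scale ratio
`1+ε₀`: already the zero-defect slice `K₁ = K₂ = 0` of `NoGlobalCascade ε₀ α X₀` fails at every starting shell (the
frozen family is a global exact pseudo-solution).
[cite: Tao2016AveragedNS, §4 Thm. 4.2 (statement shape), Lemma 4.1 (4.5)–(4.11); cell vocabulary (`NoGlobalCascade`, `IsSquareFreeCoeff`)] -/
theorem not_noGlobalCascade_of_squareFree (hsq : IsSquareFreeCoeff α) {X₀ : Fin m → ℝ}
    (hX₀ : ∀ j k, X₀ j ≠ 0 → X₀ k ≠ 0 → j = k) (ε₀ : ℝ) : ¬ NoGlobalCascade ε₀ α X₀ := by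
  intro hNG
  obtain ⟨N₀, hN₀⟩ := hNG 0 0 le_rfl le_rfl
  exact hN₀ N₀ le_rfl (hasGlobal_frozen_of_squareFree hsq hX₀ ε₀ N₀)

/-- **A square-free table never blows up robustly from a one-mode datum** (`X₀` charges only the mode `b`), any
`ε₀`. [cite: Tao2016AveragedNS, §4 Thm. 4.2 (statement shape); cell vocabulary (`NoGlobalCascade`, `IsSquareFreeCoeff`)] -/
theorem not_noGlobalCascade_oneMode_of_squareFree (hsq : IsSquareFreeCoeff α) {X₀ : Fin m → ℝ} {b : Fin m}
    (hX₀ : ∀ j, j ≠ b → X₀ j = 0) (ε₀ : ℝ) : ¬ NoGlobalCascade ε₀ α X₀ :=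
  not_noGlobalCascade_of_squareFree hsq (atMostOneMode_of_oneMode hX₀) ε₀

/-- **Below the dyadic spread no table blows up robustly from a one-mode datum.** For `α ∈ E₂(R)`, `0 < R < 2`, a
datum `X₀` charging only the mode `b`, and ANY `ε₀`: `¬ NoGlobalCascade ε₀ α X₀`.
[cite: Tao2016AveragedNS, §4 (4.2)–(4.3), Thm. 4.2 (statement shape); cell vocabulary (`InTableClass`, `NoGlobalCascade`)] -/
theorem not_noGlobalCascade_oneMode_of_lt_two (hα : InTableClass R α) (hR0 : 0 < R) (hR : R < 2)
    {X₀ : Fin m → ℝ} {b : Fin m} (hX₀ : ∀ j, j ≠ b → X₀ j = 0) (ε₀ : ℝ) : ¬ NoGlobalCascade ε₀ α X₀ :=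
  not_noGlobalCascade_oneMode_of_squareFree (isSquareFreeCoeff_of_lt_two hα hR0 hR) hX₀ ε₀

/-- **Tao's single-wavelet datum format below the dyadic spread.** For `α ∈ E₂(R)`, `0 < R < 2`, the datum
`X₀ = a·1_{i₀}` of (4.4)/(4.7) (any amplitude `a`, any mode `i₀`) and ANY `ε₀`: `¬ NoGlobalCascade ε₀ α X₀` — the
verbatim shape of Theorem 4.2 (ONE charged wavelet) is unattainable on tables of spread `< 2`; Tao's Table 1 indeed
carries the square clock `εX₁² ↦ X₂` (`not_isSquareFreeCoeff_taoCoeff`).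
[cite: Tao2016AveragedNS, §4 (4.4), (4.7), Thm. 4.2, §6.1 Table 1; cell vocabulary (`InTableClass`, `NoGlobalCascade`)] -/
theorem not_noGlobalCascade_indicator_of_lt_two (hα : InTableClass R α) (hR0 : 0 < R) (hR : R < 2)
    (i₀ : Fin m) (a ε₀ : ℝ) : ¬ NoGlobalCascade ε₀ α (fun i => if i = i₀ then a else 0) :=
  not_noGlobalCascade_oneMode_of_lt_two hα hR0 hR (b := i₀) (fun _ hj => if_neg hj) ε₀

/-! ## Numbers for the census: what a robust blow-up needs -/

/-- **Below the dyadic spread a robust blow-up charges two modes.** If `α ∈ E₂(R)`, `0 < R < 2`, and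
`NoGlobalCascade ε₀ α X₀` (any `ε₀`), then the one-shell datum `X₀` is non-zero on two DISTINCT modes.
[cite: Tao2016AveragedNS, §4 (4.2)–(4.3), Thm. 4.2 (statement shape); cell vocabulary (`InTableClass`, `NoGlobalCascade`)] -/
theorem two_modes_of_noGlobalCascade_of_lt_two (hα : InTableClass R α) (hR0 : 0 < R) (hR : R < 2)
    {X₀ : Fin m → ℝ} {ε₀ : ℝ} (hNG : NoGlobalCascade ε₀ α X₀) :
    ∃ j k : Fin m, j ≠ k ∧ X₀ j ≠ 0 ∧ X₀ k ≠ 0 := by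
  by_contra hcon
  push Not at hcon
  exact not_noGlobalCascade_of_squareFree (isSquareFreeCoeff_of_lt_two hα hR0 hR)
    (fun j k hj hk => by by_contra hjk; exact hk (hcon j k hjk hj)) ε₀ hNG

/-- **At any spread, a robust blow-up from a datum charging at most one mode needs a square coefficient.** If
`NoGlobalCascade ε₀ α X₀` (any table `α`, any `ε₀`) and `X₀` charges at most one mode, then some
`α_{j j i,μ} ≠ 0` with `μ ∈ S`, `μ₁ = μ₂` (an intra-shell square `(0,0,0)` or a square outflow `(0,0,1)` — the shape
of the clock `εX₁² ↦ X₂` of Tao's Table 1).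
[cite: Tao2016AveragedNS, §4 (4.1), Thm. 4.2, §6.1 Table 1; cell vocabulary (`NoGlobalCascade`, `IsSquareFreeCoeff`)] -/
theorem exists_sqCoeff_ne_zero_of_noGlobalCascade_oneMode {X₀ : Fin m → ℝ} {ε₀ : ℝ}
    (hX₀ : ∀ j k, X₀ j ≠ 0 → X₀ k ≠ 0 → j = k) (hNG : NoGlobalCascade ε₀ α X₀) :
    ∃ (j i : Fin m) (μ : ℤ × ℤ × ℤ), μ ∈ shiftSet ∧ μ.1 = μ.2.1 ∧ α j j i μ ≠ 0 := by
  by_contra hcon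
  push Not at hcon
  exact not_noGlobalCascade_of_squareFree (fun j i μ hμ h12 => hcon j i μ hμ h12) hX₀ ε₀ hNG

/-! ## K2(1) and the rung leaf on the sub-dyadic one-mode corner -/

/-- **K2(1) ON THE SUB-DYADIC ONE-MODE CORNER, EVERY `ε₀`.** The implication of
`TaoLadderRungTwoBreak.BlowupRigidityOne` — robust blow-up ⇒ a non-trivial (S₁)-surviving admissible DSS wave —
holds for every table of `E₂(R)` with `0 < R < 2`, every datum charging only one mode and EVERY `ε₀`, because its
hypothesis is void there (`not_noGlobalCascade_oneMode_of_lt_two`). Vacuous calibration: nothing is extracted.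
[cite: Tao2016AveragedNS, §4 Thm. 4.2 (statement shape), §6.4; cell vocabulary (K2(1))] -/
theorem blowupRigidityOne_on_oneMode_of_lt_two (hR0 : 0 < R) (hR : R < 2) (ε₀ : ℝ)
    (α : Fin 4 → Fin 4 → Fin 4 → ℤ × ℤ × ℤ → ℝ) (X₀ : Fin 4 → ℝ) (hα : InTableClass R α)
    {b : Fin 4} (hX₀ : ∀ j, j ≠ b → X₀ j = 0) (hNG : NoGlobalCascade ε₀ α X₀) :
    ∃ (q : ℕ) (π : Equiv.Perm (Fin q)) (T : ℝ) (Φ : Fin q → ℝ → Em 4),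
      IsDSSWave ε₀ α π T Φ ∧ Surviving 1 ε₀ T ∧ ∃ r x, Φ r x ≠ 0 :=
  absurd hNG (not_noGlobalCascade_oneMode_of_lt_two hα hR0 hR hX₀ ε₀)

/-- **THE RUNG LEAF ON THE SUB-DYADIC ONE-MODE CORNER, EVERY `ε₀`.** The statement of `Target` (BP-D-latt: no
robust blow-up) restricted to tables of `E₂(R)`, `0 < R < 2`, and data charging only one mode holds with NO
threshold on `ε₀`.
[cite: Tao2016AveragedNS, §4 Thm. 4.2 (statement shape); cell vocabulary (`Target` = `RungTwoBreakLatt`)] -/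
theorem target_on_oneMode_of_lt_two (hR0 : 0 < R) (hR : R < 2) (ε₀ : ℝ)
    (α : Fin 4 → Fin 4 → Fin 4 → ℤ × ℤ × ℤ → ℝ) (X₀ : Fin 4 → ℝ) (hα : InTableClass R α)
    {b : Fin 4} (hX₀ : ∀ j, j ≠ b → X₀ j = 0) : ¬ NoGlobalCascade ε₀ α X₀ :=
  not_noGlobalCascade_oneMode_of_lt_two hα hR0 hR hX₀ ε₀

end BlowupRigidityOne

end Summit.NavierStokesRegularity.NavierStokesRegularity.Theorems

end
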